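import Literature.NumberTheory.GaloisRepresentations.LocalGlobalCohomology
import Literature.NumberTheory.GaloisRepresentations.ContinuousH1
import HarnessLib

/-!
# The scalar action on `H¹(K, M)` of an `R`-linear discrete Galois module

Topic `NumberTheory/GaloisRepresentations`. Generic glue (definitions with bodies + their unfolding
lemmas; no named fact, nothing asserted, no `sorry`) on top of the tree's ℤ-linear Galois cohomology
`Literature.NumberTheory.GaloisRepresentations.galoisCohomology` (Mathlib `continuousCohomology` of the
`TopRep ℤ Γ_K` attached to a `DiscreteGaloisModule K M`).

The tree's discrete Galois modules are `ℤ`-linear (`DiscreteGaloisModule K M = GaloisRep K ℤ M`), and the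
whole Selmer layer (`localization`, `unramifiedSubgroup`, `SelmerStructure`, `selmerGroup`, `KolyvaginDatum`,
…) is built on the `ℤ`-linear `H¹(K, M)`; `GaloisCohomology/KolyvaginSystems.lean` records the consequence
«No coefficient ring is carried … TODO(general form): `R = 𝒪/π^m` needs `𝒪`-linear cohomology». When the
Galois module carries a COMMUTING action of a coefficient ring `R` — a `Module R M` structure for which every
`ρ σ` is `R`-linear, `DiscreteGaloisModule.IsScalarLinear R ρ` — the group `H¹(K, M)` is an `R`-module by
FUNCTORIALITY: `r ∈ R` acts as `H¹(r•) = galoisCohomology.map (r•) 1`, the map induced by the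
`Γ_K`-equivariant continuous endomorphism `m ↦ r • m` (`DiscreteGaloisModule.scalarIntertwining`). On explicit
classes `[φ]` of continuous crossed homomorphisms (`Literature.oneCocycleClass`, surjective by
`oneCocycleClass_surjective`) this is `r • [φ] = [r • φ]`, `(r • φ)(σ) = r • φ(σ)`
(`galoisCohomology.scalarMapH1_oneCocycleClass`), whence the module axioms
(`galoisCohomology.moduleH1` — a `def`, NOT an instance: users write
`letI := galoisCohomology.moduleH1 ρ hρ`), the agreement `((n : ℤ) : R) • x = n • x` with the existing
`ℤ`-structure (`intCast_smul_eq_zsmul`), and the naturality of the action under change of module along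
`R`-linear equivariant maps (`map_scalarMapH1`, `mapₗ`), under pull-back along any continuous homomorphism
`Γ_L → Γ_K` (`pullback_scalarMapH1`) and hence under restriction to an extension field / localisation at
a place (`res_scalarMapH1`, `resₗ`; the tree's `galoisCohomology.localization ρ v n` IS
`galoisCohomology.res ρ K_v n`). So ONE cohomology theory serves both the `ℤ`-linear Selmer layer and
`R`-linear statements («free of rank one over `R`», `R`-submodule local conditions, `len_R`), as required
by the typing of B. Howard, Compositio Math. 140 (2004) §1.1–§1.3 / Thm. 1.6.1 over an abstract
coefficient ring (cell `pub/bsd-print-x9`, (W9); REF-131 (T4) «one cohomology theory on both sides»).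

Everything here is [folklore]: Serre, *Galois Cohomology* (1997), I.§2.2 (functoriality of `Hⁿ(G, A)` in
`A`), I.§2.4 (compatible pairs), I.§5.1 (`H¹` by crossed homomorphisms); Neukirch–Schmidt–Wingberg,
*Cohomology of Number Fields*, (1.5.1) (the `R`-module structure on cohomology of an `R[G]`-module by
functoriality). Mathlib reuse: `ContIntertwiningMap`, `TopRep.ofHom`, `ContinuousCohomology.map`;
tree reuse: `galoisCohomology.map/pullback/res`, `contOneCocycles.pullback`, `map_oneCocycleClass`,
`oneCocycleClass_add/_surjective`.

Design notes. (1) `R` is any ring (`[Ring R]`), in any universe; no topology on `R` is needed because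
`M` is discrete. (2) Only degree `1` is given an `R`-module structure (the degree in which Selmer groups
and Kolyvagin systems live; additivity of `H¹(r•)` in `r` is proved through explicit cocycles); the
endomorphism `galoisCohomology.scalarMap ρ hρ n r` is defined in every degree. (3) No `instance` is
declared (TYPER LINT; and an instance would depend on the proof `hρ`); for `R = ℤ` the structure
`moduleH1 ρ _` is propositionally, not definitionally, the `AddCommGroup.toIntModule` one
(`intCast_smul_eq_zsmul`), so do not install it at `R = ℤ`.
-/

noncomputable section

open CategoryTheory
open scoped ContRepresentation

universe u v

namespace Literature.NumberTheory.GaloisRepresentations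

variable {K : Type u} [Field K] {M : Type u} [AddCommGroup M] [TopologicalSpace M]
  [DiscreteTopology M] {N : Type u} [AddCommGroup N] [TopologicalSpace N] [DiscreteTopology N]
  {R : Type v} [Ring R] [Module R M] [Module R N]

/-! ## 1. `R`-linear discrete Galois modules and the scalar endomorphisms -/

namespace DiscreteGaloisModule

variable (R) in
/-- A discrete Galois module `ρ` on an `R`-module `M` is **`R`-linear** when every `ρ σ` commutes with
the scalars: `ρ σ (r • m) = r • ρ σ m` — i.e. `M` is a discrete `R[[Γ_K]]`-module in the sense of
Howard 2004 §1 (`Mod_{R,K}`: «finitely-generated `R`-modules equipped with continuous, linear actions of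
`G_K`») minus the finiteness condition, which is not needed for the cohomological glue below.
Serre, *Galois Cohomology* (1997), I.§2.2; B. Howard, Compositio Math. 140 (2004), §1 (conventions).
[cite: Howard2004HeegnerKolyvagin, §1 conventions (Mod_{R,K}) and Def. 1.1.1 (arXiv:1202.6340 p0005 L3–24)] [cite: SerreGaloisCohomology1997, Ch. I §2.2 (functoriality of Hⁿ(G, A) in A) and §5.1 (H¹ via cocycles)] -/
def IsScalarLinear (ρ : DiscreteGaloisModule K M) : Prop :=
  ∀ (σ : Field.absoluteGaloisGroup K) (r : R) (m : M), ρ σ (r • m) = r • ρ σ m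

/-- Unfolding `IsScalarLinear`. [cite: Howard2004HeegnerKolyvagin, §1 conventions (Mod_{R,K}) and Def. 1.1.1 (arXiv:1202.6340 p0005 L3–24)] [cite: SerreGaloisCohomology1997, Ch. I §2.2 (functoriality of Hⁿ(G, A) in A) and §5.1 (H¹ via cocycles)] -/
theorem isScalarLinear_iff (ρ : DiscreteGaloisModule K M) :
    ρ.IsScalarLinear R ↔
      ∀ (σ : Field.absoluteGaloisGroup K) (r : R) (m : M), ρ σ (r • m) = r • ρ σ m :=
  Iff.rfl

/-- Every discrete Galois module is `ℤ`-linear (the operators are additive). [cite: Howard2004HeegnerKolyvagin, §1 conventions (Mod_{R,K}) and Def. 1.1.1 (arXiv:1202.6340 p0005 L3–24)] [cite: SerreGaloisCohomology1997, Ch. I §2.2 (functoriality of Hⁿ(G, A) in A) and §5.1 (H¹ via cocycles)] -/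
theorem isScalarLinear_int (ρ : DiscreteGaloisModule K M) : ρ.IsScalarLinear ℤ :=
  fun σ n m => map_zsmul (ρ σ) n m

/-- `R`-linearity is inherited by the restriction `M|_{Γ_L}` along any continuous homomorphism
`Γ_L → Γ_K` (`ContinuousRep.restrict`): the operators are among the old ones. [cite: Howard2004HeegnerKolyvagin, §1 conventions (Mod_{R,K}) and Def. 1.1.1 (arXiv:1202.6340 p0005 L3–24)] [cite: SerreGaloisCohomology1997, Ch. I §2.2 (functoriality of Hⁿ(G, A) in A) and §5.1 (H¹ via cocycles)] -/
theorem IsScalarLinear.restrict {L : Type u} [Field L] {ρ : DiscreteGaloisModule K M}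
    (hρ : ρ.IsScalarLinear R) (φ : Field.absoluteGaloisGroup L →ₜ* Field.absoluteGaloisGroup K) :
    IsScalarLinear R (K := L) (ContinuousRep.restrict ρ φ) :=
  fun σ r m => hρ (φ σ) r m

/-- `R`-linearity is inherited by the restriction `M|_{Γ_L}` to an extension field `L/K`
(`GaloisRep.restrictField`; in particular by the local module `ρ.toLocal v = ρ.restrictField K_v`).
[cite: Howard2004HeegnerKolyvagin, §1 conventions (Mod_{R,K}) and Def. 1.1.1 (arXiv:1202.6340 p0005 L3–24)] [cite: SerreGaloisCohomology1997, Ch. I §2.2 (functoriality of Hⁿ(G, A) in A) and §5.1 (H¹ via cocycles)] -/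
theorem IsScalarLinear.restrictField {ρ : DiscreteGaloisModule K M} (hρ : ρ.IsScalarLinear R)
    (L : Type u) [Field L] [Algebra K L] : IsScalarLinear R (GaloisRep.restrictField L ρ) :=
  fun σ r m => hρ (absGaloisRestrict K L σ) r m

/-- **The scalar `r` as a continuous `Γ_K`-intertwining endomorphism** `m ↦ r • m` of the discrete module
(continuity is free on a discrete space; equivariance is `IsScalarLinear`). This is the morphism whose
`H¹` is the action of `r` on `H¹(K, M)`. Serre, *Galois Cohomology* (1997), I.§2.2. [cite: Howard2004HeegnerKolyvagin, §1 conventions (Mod_{R,K}) and Def. 1.1.1 (arXiv:1202.6340 p0005 L3–24)] [cite: SerreGaloisCohomology1997, Ch. I §2.2 (functoriality of Hⁿ(G, A) in A) and §5.1 (H¹ via cocycles)] -/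
def scalarIntertwining (ρ : DiscreteGaloisModule K M) (hρ : ρ.IsScalarLinear R) (r : R) :
    ρ.toContRepresentation →ⁱL ρ.toContRepresentation where
  toContinuousLinearMap :=
    ⟨(DistribSMul.toAddMonoidHom M r).toIntLinearMap, continuous_of_discreteTopology⟩
  isIntertwining' σ := by
    ext m
    change r • ρ σ m = ρ σ (r • m)
    exact (hρ σ r m).symm

/-- Unfolding `scalarIntertwining`: it is `m ↦ r • m`. [cite: Howard2004HeegnerKolyvagin, §1 conventions (Mod_{R,K}) and Def. 1.1.1 (arXiv:1202.6340 p0005 L3–24)] [cite: SerreGaloisCohomology1997, Ch. I §2.2 (functoriality of Hⁿ(G, A) in A) and §5.1 (H¹ via cocycles)] -/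
@[simp]
theorem scalarIntertwining_apply (ρ : DiscreteGaloisModule K M) (hρ : ρ.IsScalarLinear R) (r : R)
    (m : M) : scalarIntertwining ρ hρ r m = r • m :=
  rfl

end DiscreteGaloisModule

open DiscreteGaloisModule

/-! ## 2. The action on cohomology: `H¹(r•)` and its description on cocycles -/

namespace galoisCohomology

/-- **`r` acting on `Hⁿ(K, M)`**: the endomorphism `Hⁿ(r•) = galoisCohomology.map (r•) n` induced by the
scalar `r` (functoriality of cohomology in the coefficients). Serre, *Galois Cohomology* (1997), I.§2.2;
NSW (1.5.1). [cite: SerreGaloisCohomology1997, Ch. I §2.2 (functoriality of Hⁿ(G, A) in A) and §5.1 (H¹ via cocycles)] -/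
def scalarMap (ρ : DiscreteGaloisModule K M) (hρ : ρ.IsScalarLinear R) (n : ℕ) (r : R) :
    galoisCohomology ρ n →+ galoisCohomology ρ n :=
  galoisCohomology.map (scalarIntertwining ρ hρ r) n

/-- **`r` acting on `H¹(K, M)`** (`= scalarMap ρ hρ 1 r`). [cite: SerreGaloisCohomology1997, Ch. I §2.2 (functoriality of Hⁿ(G, A) in A) and §5.1 (H¹ via cocycles)] -/
abbrev scalarMapH1 (ρ : DiscreteGaloisModule K M) (hρ : ρ.IsScalarLinear R) (r : R) :
    galoisCohomology ρ 1 →+ galoisCohomology ρ 1 :=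
  scalarMap ρ hρ 1 r

/-- **The scalar multiple `r • φ` of a continuous crossed homomorphism** `φ : Γ_K → M`,
`(r • φ)(σ) = r • φ(σ)` — the pull-back of `φ` along the compatible pair `(id, r•)`
(`contOneCocycles.pullback`), so again a continuous crossed homomorphism. Serre, *Galois Cohomology*
(1997), I.§2.4, I.§5.1. [cite: SerreGaloisCohomology1997, Ch. I §2.2 (functoriality of Hⁿ(G, A) in A) and §5.1 (H¹ via cocycles)] -/
def scalarCocycle (ρ : DiscreteGaloisModule K M) (hρ : ρ.IsScalarLinear R) (r : R)
    (φ : contOneCocycles ρ.toTopRep) : contOneCocycles ρ.toTopRep :=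
  contOneCocycles.pullback (ContinuousMonoidHom.id (Field.absoluteGaloisGroup K))
    (X := ρ.toTopRep) (Y := ρ.toTopRep) (TopRep.ofHom (scalarIntertwining ρ hρ r)) φ

/-- `(r • φ)(σ) = r • φ(σ)`. [cite: SerreGaloisCohomology1997, Ch. I §2.2 (functoriality of Hⁿ(G, A) in A) and §5.1 (H¹ via cocycles)] -/
@[simp]
theorem scalarCocycle_apply (ρ : DiscreteGaloisModule K M) (hρ : ρ.IsScalarLinear R) (r : R)
    (φ : contOneCocycles ρ.toTopRep) (σ : Field.absoluteGaloisGroup K) :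
    (scalarCocycle ρ hρ r φ).1 σ = r • φ.1 σ :=
  rfl

/-- **`H¹(r•) [φ] = [r • φ]`** (Mathlib's functoriality on explicit cocycle classes,
`map_oneCocycleClass`). Serre, *Galois Cohomology* (1997), I.§2.2, I.§5.1. [cite: SerreGaloisCohomology1997, Ch. I §2.2 (functoriality of Hⁿ(G, A) in A) and §5.1 (H¹ via cocycles)] -/
theorem scalarMapH1_oneCocycleClass (ρ : DiscreteGaloisModule K M) (hρ : ρ.IsScalarLinear R) (r : R)
    (φ : contOneCocycles ρ.toTopRep) :
    scalarMapH1 ρ hρ r (oneCocycleClass ρ.toTopRep φ) =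
      oneCocycleClass ρ.toTopRep (scalarCocycle ρ hρ r φ) :=
  map_oneCocycleClass _ _ _ φ

section Cocycles

variable (ρ : DiscreteGaloisModule K M) (hρ : ρ.IsScalarLinear R)

/-- `1 • φ = φ`. [cite: SerreGaloisCohomology1997, Ch. I §2.2 (functoriality of Hⁿ(G, A) in A) and §5.1 (H¹ via cocycles)] -/
theorem scalarCocycle_one (φ : contOneCocycles ρ.toTopRep) : scalarCocycle ρ hρ 1 φ = φ :=
  Subtype.ext (ContinuousMap.ext fun σ => by rw [scalarCocycle_apply, one_smul])

/-- `(r * s) • φ = r • (s • φ)`. [cite: SerreGaloisCohomology1997, Ch. I §2.2 (functoriality of Hⁿ(G, A) in A) and §5.1 (H¹ via cocycles)] -/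
theorem scalarCocycle_mul (r s : R) (φ : contOneCocycles ρ.toTopRep) :
    scalarCocycle ρ hρ (r * s) φ = scalarCocycle ρ hρ r (scalarCocycle ρ hρ s φ) :=
  Subtype.ext (ContinuousMap.ext fun σ => by
    rw [scalarCocycle_apply, scalarCocycle_apply, scalarCocycle_apply, mul_smul])

/-- `(r + s) • φ = r • φ + s • φ`. [cite: SerreGaloisCohomology1997, Ch. I §2.2 (functoriality of Hⁿ(G, A) in A) and §5.1 (H¹ via cocycles)] -/
theorem scalarCocycle_add (r s : R) (φ : contOneCocycles ρ.toTopRep) :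
    scalarCocycle ρ hρ (r + s) φ = scalarCocycle ρ hρ r φ + scalarCocycle ρ hρ s φ :=
  Subtype.ext (ContinuousMap.ext fun σ => by
    rw [scalarCocycle_apply, add_smul]
    rfl)

/-- `r • (φ + ψ) = r • φ + r • ψ`. [cite: SerreGaloisCohomology1997, Ch. I §2.2 (functoriality of Hⁿ(G, A) in A) and §5.1 (H¹ via cocycles)] -/
theorem scalarCocycle_add_right (r : R) (φ ψ : contOneCocycles ρ.toTopRep) :
    scalarCocycle ρ hρ r (φ + ψ) = scalarCocycle ρ hρ r φ + scalarCocycle ρ hρ r ψ :=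
  Subtype.ext (ContinuousMap.ext fun σ => by
    rw [scalarCocycle_apply]
    change r • (φ.1 σ + ψ.1 σ) = r • φ.1 σ + r • ψ.1 σ
    rw [smul_add])

/-- `0 • φ = 0`. [cite: SerreGaloisCohomology1997, Ch. I §2.2 (functoriality of Hⁿ(G, A) in A) and §5.1 (H¹ via cocycles)] -/
theorem scalarCocycle_zero (φ : contOneCocycles ρ.toTopRep) : scalarCocycle ρ hρ 0 φ = 0 :=
  Subtype.ext (ContinuousMap.ext fun σ => by
    rw [scalarCocycle_apply, zero_smul]
    rfl)

/-- `(n : R) • φ = n • φ` for an integer `n` (the `ℤ`-structure of the cocycle group). [cite: SerreGaloisCohomology1997, Ch. I §2.2 (functoriality of Hⁿ(G, A) in A) and §5.1 (H¹ via cocycles)] -/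
theorem scalarCocycle_intCast (n : ℤ) (φ : contOneCocycles ρ.toTopRep) :
    scalarCocycle ρ hρ (n : R) φ = n • φ :=
  Subtype.ext (ContinuousMap.ext fun σ => by
    rw [scalarCocycle_apply, Int.cast_smul_eq_zsmul]
    rfl)

end Cocycles

/-! ## 3. The endomorphisms `H¹(r•)`: ring axioms -/

section Endomorphisms

variable (ρ : DiscreteGaloisModule K M) (hρ : ρ.IsScalarLinear R)

/-- `H¹(1•) = id`. [cite: SerreGaloisCohomology1997, Ch. I §2.2 (functoriality of Hⁿ(G, A) in A) and §5.1 (H¹ via cocycles)] -/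
theorem scalarMapH1_one : scalarMapH1 ρ hρ 1 = AddMonoidHom.id _ := by
  refine AddMonoidHom.ext fun x => ?_
  obtain ⟨φ, rfl⟩ := oneCocycleClass_surjective ρ.toTopRep x
  rw [scalarMapH1_oneCocycleClass, scalarCocycle_one]
  rfl

/-- `H¹((r s)•) = H¹(r•) ∘ H¹(s•)`. [cite: SerreGaloisCohomology1997, Ch. I §2.2 (functoriality of Hⁿ(G, A) in A) and §5.1 (H¹ via cocycles)] -/
theorem scalarMapH1_mul (r s : R) :
    scalarMapH1 ρ hρ (r * s) = (scalarMapH1 ρ hρ r).comp (scalarMapH1 ρ hρ s) := by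
  refine AddMonoidHom.ext fun x => ?_
  obtain ⟨φ, rfl⟩ := oneCocycleClass_surjective ρ.toTopRep x
  rw [AddMonoidHom.comp_apply, scalarMapH1_oneCocycleClass, scalarMapH1_oneCocycleClass,
    scalarMapH1_oneCocycleClass, scalarCocycle_mul]

/-- **Additivity in the scalar**: `H¹((r + s)•) = H¹(r•) + H¹(s•)` (through explicit cocycles:
`[(r+s) • φ] = [r • φ] + [s • φ]`). [cite: SerreGaloisCohomology1997, Ch. I §2.2 (functoriality of Hⁿ(G, A) in A) and §5.1 (H¹ via cocycles)] -/
theorem scalarMapH1_add (r s : R) :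
    scalarMapH1 ρ hρ (r + s) = scalarMapH1 ρ hρ r + scalarMapH1 ρ hρ s := by
  refine AddMonoidHom.ext fun x => ?_
  obtain ⟨φ, rfl⟩ := oneCocycleClass_surjective ρ.toTopRep x
  rw [AddMonoidHom.add_apply, scalarMapH1_oneCocycleClass, scalarMapH1_oneCocycleClass,
    scalarMapH1_oneCocycleClass, scalarCocycle_add, oneCocycleClass_add]
  rfl

/-- `H¹(0•) = 0`. [cite: SerreGaloisCohomology1997, Ch. I §2.2 (functoriality of Hⁿ(G, A) in A) and §5.1 (H¹ via cocycles)] -/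
theorem scalarMapH1_zero : scalarMapH1 ρ hρ 0 = 0 := by
  refine AddMonoidHom.ext fun x => ?_
  obtain ⟨φ, rfl⟩ := oneCocycleClass_surjective ρ.toTopRep x
  rw [scalarMapH1_oneCocycleClass, scalarCocycle_zero, oneCocycleClass_zero]
  rfl

/-- `H¹((n : R)•) x = n • x` for an integer `n`: on integers the functorial action is the existing
`ℤ`-structure of the group `H¹(K, M)`. [cite: SerreGaloisCohomology1997, Ch. I §2.2 (functoriality of Hⁿ(G, A) in A) and §5.1 (H¹ via cocycles)] -/
theorem scalarMapH1_intCast (n : ℤ) (x : galoisCohomology ρ 1) :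
    scalarMapH1 ρ hρ (n : R) x = n • x := by
  obtain ⟨φ, rfl⟩ := oneCocycleClass_surjective ρ.toTopRep x
  rw [scalarMapH1_oneCocycleClass, scalarCocycle_intCast]
  exact map_zsmul (oneCocycleClassₗ ρ.toTopRep) n φ

end Endomorphisms

/-! ## 4. The `R`-module structure on `H¹(K, M)` (a `def`, not an instance) -/

section ModuleStructure

variable (ρ : DiscreteGaloisModule K M) (hρ : ρ.IsScalarLinear R)

/-- **The `R`-module `H¹(K, M)` of an `R`-linear discrete Galois module**: `r • x := H¹(r•) x`
(functoriality of cohomology in the coefficients; on cocycle classes `r • [φ] = [r • φ]`). A `def`,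
to be installed locally with `letI := galoisCohomology.moduleH1 ρ hρ`. Serre, *Galois Cohomology*
(1997), I.§2.2; NSW (1.5.1); B. Howard, Compositio Math. 140 (2004), §1.1 («a local condition … is a
choice of `R`-submodule of `H¹(K_v, T)`»). [cite: Howard2004HeegnerKolyvagin, §1 conventions (Mod_{R,K}) and Def. 1.1.1 (arXiv:1202.6340 p0005 L3–24)] [cite: SerreGaloisCohomology1997, Ch. I §2.2 (functoriality of Hⁿ(G, A) in A) and §5.1 (H¹ via cocycles)] -/
@[reducible]
def moduleH1 : Module R (galoisCohomology ρ 1) where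
  smul r x := scalarMapH1 ρ hρ r x
  one_smul x := by
    change scalarMapH1 ρ hρ 1 x = x
    rw [scalarMapH1_one]; rfl
  mul_smul r s x := by
    change scalarMapH1 ρ hρ (r * s) x = scalarMapH1 ρ hρ r (scalarMapH1 ρ hρ s x)
    rw [scalarMapH1_mul]; rfl
  smul_zero r := by
    change scalarMapH1 ρ hρ r 0 = 0
    exact map_zero _
  smul_add r x y := by
    change scalarMapH1 ρ hρ r (x + y) = scalarMapH1 ρ hρ r x + scalarMapH1 ρ hρ r y
    exact map_add _ x y
  add_smul r s x := by
    change scalarMapH1 ρ hρ (r + s) x = scalarMapH1 ρ hρ r x + scalarMapH1 ρ hρ s x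
    rw [scalarMapH1_add]; rfl
  zero_smul x := by
    change scalarMapH1 ρ hρ 0 x = 0
    rw [scalarMapH1_zero]; rfl

/-- Unfolding the `R`-action: `r • x = H¹(r•) x`. [cite: Howard2004HeegnerKolyvagin, §1 conventions (Mod_{R,K}) and Def. 1.1.1 (arXiv:1202.6340 p0005 L3–24)] [cite: SerreGaloisCohomology1997, Ch. I §2.2 (functoriality of Hⁿ(G, A) in A) and §5.1 (H¹ via cocycles)] -/
theorem smul_def (r : R) (x : galoisCohomology ρ 1) :
    (letI := moduleH1 ρ hρ; r • x) = scalarMapH1 ρ hρ r x :=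
  rfl

/-- **`r • [φ] = [r • φ]`** on classes of continuous crossed homomorphisms. [cite: Howard2004HeegnerKolyvagin, §1 conventions (Mod_{R,K}) and Def. 1.1.1 (arXiv:1202.6340 p0005 L3–24)] [cite: SerreGaloisCohomology1997, Ch. I §2.2 (functoriality of Hⁿ(G, A) in A) and §5.1 (H¹ via cocycles)] -/
theorem smul_oneCocycleClass (r : R) (φ : contOneCocycles ρ.toTopRep) :
    (letI := moduleH1 ρ hρ; r • (show galoisCohomology ρ 1 from oneCocycleClass ρ.toTopRep φ)) =
      oneCocycleClass ρ.toTopRep (scalarCocycle ρ hρ r φ) :=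
  scalarMapH1_oneCocycleClass ρ hρ r φ

/-- The functorial `R`-action restricted to the integers is the `ℤ`-structure of the abelian group
`H¹(K, M)`: `((n : ℤ) : R) • x = n • x`. [cite: SerreGaloisCohomology1997, Ch. I §2.2 (functoriality of Hⁿ(G, A) in A) and §5.1 (H¹ via cocycles)] -/
theorem intCast_smul_eq_zsmul (n : ℤ) (x : galoisCohomology ρ 1) :
    (letI := moduleH1 ρ hρ; ((n : R) • x)) = n • x :=
  scalarMapH1_intCast ρ hρ n x

/-- `((n : ℕ) : R) • x = n • x`. [cite: SerreGaloisCohomology1997, Ch. I §2.2 (functoriality of Hⁿ(G, A) in A) and §5.1 (H¹ via cocycles)] -/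
theorem natCast_smul_eq_nsmul (n : ℕ) (x : galoisCohomology ρ 1) :
    (letI := moduleH1 ρ hρ; ((n : R) • x)) = n • x := by
  have h := intCast_smul_eq_zsmul ρ hρ (n : ℤ) x
  rw [Int.cast_natCast, natCast_zsmul] at h
  exact h

/-- An element of `R` acting as an INTEGER on `M` acts as that integer on `H¹(K, M)`: if
`r • m = n • m` for all `m`, then `r • x = n • x` (e.g. `R = ℤ/Nℤ`-type coefficients acting on an
`N`-torsion module through `ℤ`). [cite: Howard2004HeegnerKolyvagin, §1 conventions (Mod_{R,K}) and Def. 1.1.1 (arXiv:1202.6340 p0005 L3–24)] [cite: SerreGaloisCohomology1997, Ch. I §2.2 (functoriality of Hⁿ(G, A) in A) and §5.1 (H¹ via cocycles)] -/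
theorem smul_eq_zsmul_of_forall (r : R) (n : ℤ) (h : ∀ m : M, r • m = n • m)
    (x : galoisCohomology ρ 1) : (letI := moduleH1 ρ hρ; r • x) = n • x := by
  obtain ⟨φ, rfl⟩ := oneCocycleClass_surjective ρ.toTopRep x
  rw [smul_def, scalarMapH1_oneCocycleClass]
  have hφ : scalarCocycle ρ hρ r φ = n • φ :=
    Subtype.ext (ContinuousMap.ext fun σ => by rw [scalarCocycle_apply, h]; rfl)
  rw [hφ]
  exact map_zsmul (oneCocycleClassₗ ρ.toTopRep) n φ

/-- If `r` kills `M` then `r` kills `H¹(K, M)`. [cite: Howard2004HeegnerKolyvagin, §1 conventions (Mod_{R,K}) and Def. 1.1.1 (arXiv:1202.6340 p0005 L3–24)] [cite: SerreGaloisCohomology1997, Ch. I §2.2 (functoriality of Hⁿ(G, A) in A) and §5.1 (H¹ via cocycles)] -/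
theorem smul_eq_zero_of_forall (r : R) (h : ∀ m : M, r • m = 0) (x : galoisCohomology ρ 1) :
    (letI := moduleH1 ρ hρ; r • x) = 0 := by
  have h' := smul_eq_zsmul_of_forall ρ hρ r 0 (fun m => by rw [h m, zero_smul]) x
  rwa [zero_smul] at h'

end ModuleStructure

/-! ## 5. Naturality: change of module, pull-back, restriction / localisation -/

section Naturality

variable {ρ : DiscreteGaloisModule K M} {ρ' : DiscreteGaloisModule K N}

/-- **Change of module commutes with the scalar action**: for an `R`-linear equivariant continuous map
`f : M → N` of `R`-linear discrete Galois modules, `H¹(f) (H¹(r•) x) = H¹(r•) (H¹(f) x)` (both are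
`[f ∘ (r • φ)] = [r • (f ∘ φ)]`). Serre, *Galois Cohomology* (1997), I.§2.2. [cite: SerreGaloisCohomology1997, Ch. I §2.4 (compatible pairs)] -/
theorem map_scalarMapH1 (hρ : ρ.IsScalarLinear R) (hρ' : ρ'.IsScalarLinear R)
    (f : ρ.toContRepresentation →ⁱL ρ'.toContRepresentation) (hf : ∀ (r : R) (m : M), f (r • m) = r • f m)
    (r : R) (x : galoisCohomology ρ 1) :
    galoisCohomology.map f 1 (scalarMapH1 ρ hρ r x) =
      scalarMapH1 ρ' hρ' r (galoisCohomology.map f 1 x) := by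
  obtain ⟨φ, rfl⟩ := oneCocycleClass_surjective ρ.toTopRep x
  rw [scalarMapH1_oneCocycleClass]
  change ContinuousCohomology.map _ _ 1 _ = scalarMapH1 ρ' hρ' r (ContinuousCohomology.map _ _ 1 _)
  rw [map_oneCocycleClass, map_oneCocycleClass, scalarMapH1_oneCocycleClass]
  exact congrArg _ (Subtype.ext (ContinuousMap.ext fun σ => hf r (φ.1 σ)))

/-- `H¹(f)` is `R`-LINEAR for the two functorial module structures, `f` an `R`-linear equivariant
continuous map. [cite: SerreGaloisCohomology1997, Ch. I §2.4 (compatible pairs)] -/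
def mapₗ (hρ : ρ.IsScalarLinear R) (hρ' : ρ'.IsScalarLinear R)
    (f : ρ.toContRepresentation →ⁱL ρ'.toContRepresentation)
    (hf : ∀ (r : R) (m : M), f (r • m) = r • f m) :
    letI := moduleH1 ρ hρ; letI := moduleH1 ρ' hρ'
    galoisCohomology ρ 1 →ₗ[R] galoisCohomology ρ' 1 :=
  letI := moduleH1 ρ hρ; letI := moduleH1 ρ' hρ'
  { toFun := galoisCohomology.map f 1
    map_add' := map_add _
    map_smul' := fun r x => map_scalarMapH1 hρ hρ' f hf r x }

/-- Unfolding `mapₗ`: it is `galoisCohomology.map f 1`. [cite: SerreGaloisCohomology1997, Ch. I §2.4 (compatible pairs)] -/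
theorem mapₗ_apply (hρ : ρ.IsScalarLinear R) (hρ' : ρ'.IsScalarLinear R)
    (f : ρ.toContRepresentation →ⁱL ρ'.toContRepresentation)
    (hf : ∀ (r : R) (m : M), f (r • m) = r • f m) (x : galoisCohomology ρ 1) :
    mapₗ hρ hρ' f hf x = galoisCohomology.map f 1 x :=
  rfl

/-- `φ^* [c] = [c ∘ φ]` for the pull-back `galoisCohomology.pullback ρ φ 1` along a continuous
homomorphism `φ : Γ_L → Γ_K` on classes of continuous crossed homomorphisms (Mathlib functoriality,
`map_oneCocycleClass`). Serre, *Galois Cohomology* (1997), I.§2.4. [cite: SerreGaloisCohomology1997, Ch. I §2.4 (compatible pairs)] -/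
theorem pullback_one_oneCocycleClass {L : Type u} [Field L] (ρ : DiscreteGaloisModule K M)
    (φ : Field.absoluteGaloisGroup L →ₜ* Field.absoluteGaloisGroup K) (c : contOneCocycles ρ.toTopRep) :
    galoisCohomology.pullback ρ φ 1 (oneCocycleClass ρ.toTopRep c) =
      oneCocycleClass (DiscreteGaloisModule.toTopRep (ContinuousRep.restrict ρ φ))
        (contOneCocycles.pullback φ (X := ρ.toTopRep)
          (Y := DiscreteGaloisModule.toTopRep (ContinuousRep.restrict ρ φ))
          (TopRep.ofHom ⟨ContinuousLinearMap.id ℤ M, fun _ => rfl⟩) c) :=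
  map_oneCocycleClass _ _ _ c

/-- **Pull-back commutes with the scalar action**: for a continuous homomorphism `φ : Γ_L → Γ_K`
(`Γ_L` acting on `M` through `φ`), `φ^* (H¹(r•) x) = H¹(r•) (φ^* x)` (both are `[r • (c ∘ φ)]`).
Serre, *Galois Cohomology* (1997), I.§2.4 (compatible pairs). [cite: SerreGaloisCohomology1997, Ch. I §2.4 (compatible pairs)] -/
theorem pullback_scalarMapH1 {L : Type u} [Field L] (hρ : ρ.IsScalarLinear R)
    (φ : Field.absoluteGaloisGroup L →ₜ* Field.absoluteGaloisGroup K) (r : R)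
    (x : galoisCohomology ρ 1) :
    galoisCohomology.pullback ρ φ 1 (scalarMapH1 ρ hρ r x) =
      scalarMapH1 (ContinuousRep.restrict ρ φ) (hρ.restrict φ) r (galoisCohomology.pullback ρ φ 1 x) := by
  obtain ⟨c, rfl⟩ := oneCocycleClass_surjective ρ.toTopRep x
  rw [scalarMapH1_oneCocycleClass, pullback_one_oneCocycleClass, pullback_one_oneCocycleClass,
    scalarMapH1_oneCocycleClass]
  exact congrArg _ (Subtype.ext (ContinuousMap.ext fun σ => rfl))

/-- **Restriction to an extension field commutes with the scalar action**:
`res_{L/K} (H¹(r•) x) = H¹(r•) (res_{L/K} x)`; with `L = K_v` this is the LOCALISATION map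
(`galoisCohomology.localization ρ v 1 = galoisCohomology.res ρ K_v 1`, `ρ.toLocal v = ρ.restrictField K_v`).
Serre, *Galois Cohomology* (1997), I.§2.4; II.§6.1. [cite: SerreGaloisCohomology1997, Ch. I §2.4 (compatible pairs)] -/
theorem res_scalarMapH1 (hρ : ρ.IsScalarLinear R) (L : Type u) [Field L] [Algebra K L] (r : R)
    (x : galoisCohomology ρ 1) :
    galoisCohomology.res ρ L 1 (scalarMapH1 ρ hρ r x) =
      scalarMapH1 (GaloisRep.restrictField L ρ) (hρ.restrictField L) r (galoisCohomology.res ρ L 1 x) :=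
  pullback_scalarMapH1 hρ (absGaloisRestrict K L) r x

/-- **Localisation at a place commutes with the scalar action**: `loc_v (H¹(r•) x) = H¹(r•) (loc_v x)` for
the tree's `galoisCohomology.localization ρ v 1 : H¹(K, M) → H¹(K_v, M)` (which is `res` to the completion
`K_v`; the local module `ρ.toLocal v` is `R`-linear by `IsScalarLinear.restrictField`). Milne, *Arithmetic
Duality Theorems* (2006), I.§4; Serre, *Galois Cohomology* (1997), II.§6.1. [cite: SerreGaloisCohomology1997, Ch. I §2.4 (compatible pairs)] [cite: MilneADT2006, Ch. I §4 (localisation maps)] -/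
theorem localization_scalarMapH1 [NumberField K] (hρ : ρ.IsScalarLinear R) (v : NumberField.Place K) (r : R)
    (x : galoisCohomology ρ 1) :
    galoisCohomology.localization ρ v 1 (scalarMapH1 ρ hρ r x) =
      scalarMapH1 (ρ.toLocal v) (hρ.restrictField (NumberField.Place.Completion v)) r
        (galoisCohomology.localization ρ v 1 x) :=
  res_scalarMapH1 hρ (NumberField.Place.Completion v) r x

/-- The restriction `res_{L/K} : H¹(K, M) → H¹(L, M)` is `R`-LINEAR for the functorial module structures
(in particular so is every localisation map `H¹(K, M) → H¹(K_v, M)`). [cite: SerreGaloisCohomology1997, Ch. I §2.4 (compatible pairs)] -/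
def resₗ (hρ : ρ.IsScalarLinear R) (L : Type u) [Field L] [Algebra K L] :
    letI := moduleH1 ρ hρ; letI := moduleH1 (GaloisRep.restrictField L ρ) (hρ.restrictField L)
    galoisCohomology ρ 1 →ₗ[R] galoisCohomology (GaloisRep.restrictField L ρ) 1 :=
  letI := moduleH1 ρ hρ; letI := moduleH1 (GaloisRep.restrictField L ρ) (hρ.restrictField L)
  { toFun := galoisCohomology.res ρ L 1
    map_add' := map_add _
    map_smul' := fun r x => res_scalarMapH1 hρ L r x }

/-- Unfolding `resₗ`: it is `galoisCohomology.res ρ L 1`. [cite: SerreGaloisCohomology1997, Ch. I §2.4 (compatible pairs)] -/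
theorem resₗ_apply (hρ : ρ.IsScalarLinear R) (L : Type u) [Field L] [Algebra K L]
    (x : galoisCohomology ρ 1) : resₗ hρ L x = galoisCohomology.res ρ L 1 x :=
  rfl

/-- An additive subgroup of `H¹(K, M)` stable under all `H¹(r•)` is an `R`-SUBMODULE for the functorial
structure (how `ℤ`-linear local conditions / Selmer groups of the tree are promoted to Howard's
«`R`-submodule of `H¹(K_v, T)`»). [cite: Howard2004HeegnerKolyvagin, §1 conventions (Mod_{R,K}) and Def. 1.1.1 (arXiv:1202.6340 p0005 L3–24)] [cite: SerreGaloisCohomology1997, Ch. I §2.2 (functoriality of Hⁿ(G, A) in A) and §5.1 (H¹ via cocycles)] -/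
def submoduleOfStable (hρ : ρ.IsScalarLinear R) (S : AddSubgroup (galoisCohomology ρ 1))
    (hS : ∀ (r : R) {x}, x ∈ S → scalarMapH1 ρ hρ r x ∈ S) :
    letI := moduleH1 ρ hρ; Submodule R (galoisCohomology ρ 1) :=
  letI := moduleH1 ρ hρ
  { carrier := S
    add_mem' := S.add_mem
    zero_mem' := S.zero_mem
    smul_mem' := fun r _ hx => hS r hx }

/-- Membership in `submoduleOfStable` is membership in the subgroup. [cite: Howard2004HeegnerKolyvagin, §1 conventions (Mod_{R,K}) and Def. 1.1.1 (arXiv:1202.6340 p0005 L3–24)] [cite: SerreGaloisCohomology1997, Ch. I §2.2 (functoriality of Hⁿ(G, A) in A) and §5.1 (H¹ via cocycles)] -/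
@[simp]
theorem mem_submoduleOfStable_iff (hρ : ρ.IsScalarLinear R) (S : AddSubgroup (galoisCohomology ρ 1))
    (hS : ∀ (r : R) {x}, x ∈ S → scalarMapH1 ρ hρ r x ∈ S) (x : galoisCohomology ρ 1) :
    x ∈ submoduleOfStable hρ S hS ↔ x ∈ S :=
  Iff.rfl

/-- The kernel of a map commuting with the scalar actions is stable (so `submoduleOfStable` applies to
kernels of `R`-linear maps such as localisations: e.g. the unramified / strict / transverse subgroups
defined as kernels of restriction maps). [cite: Howard2004HeegnerKolyvagin, §1 conventions (Mod_{R,K}) and Def. 1.1.1 (arXiv:1202.6340 p0005 L3–24)] [cite: SerreGaloisCohomology1997, Ch. I §2.2 (functoriality of Hⁿ(G, A) in A) and §5.1 (H¹ via cocycles)] -/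
theorem scalarMapH1_mem_ker {P : Type*} [AddCommGroup P] (hρ : ρ.IsScalarLinear R)
    (g : galoisCohomology ρ 1 →+ P) (t : R → P →+ P)
    (hg : ∀ (r : R) (x : galoisCohomology ρ 1), g (scalarMapH1 ρ hρ r x) = t r (g x))
    (r : R) {x : galoisCohomology ρ 1} (hx : x ∈ g.ker) : scalarMapH1 ρ hρ r x ∈ g.ker := by
  rw [AddMonoidHom.mem_ker] at hx ⊢
  rw [hg, hx, map_zero]

end Naturality

end galoisCohomology

end Literature.NumberTheory.GaloisRepresentations

end
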